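import Literature.Algebra.Homology.OrderedCechRestrict
import Literature.Algebra.Homology.FiniteFreeResolution
import Mathlib.Data.Finset.Preimage
import HarnessLib

/-!
# Deleting acyclic members of a covering: the restriction of the ordered Čech complex to a
# sub-covering is a quasi-isomorphism, by one-vertex induction (Görtz–Wedhorn II, Thm. 22.9)

Let `F : Finset ι → Submodule A 𝕂` be a monotone family and `Č•(F)` its ordered Čech complex
(`Literature/Algebra/Homology/OrderedCech`; for a subsheaf `𝓕 ⊆ 𝒦` of a constant sheaf and a
finite covering `𝓦 = (W_i)_{i ∈ ι}` with all `W_s = ⋂_{i ∈ s} W_i` non-empty, `F s = Γ(W_s, 𝓕)`),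
and `e : ι' ↪o ι` an order embedding of index sets (a sub-covering `(W_{e i'})_{i'}`).
`Literature/Algebra/Homology/OrderedCechRestrict` constructs the restriction
`OrderedCech.restrictMap e F hF : Č•(F) → Č•(F ∘ e)` and proves that it is a quasi-isomorphism
when all LINKS are exact (`OrderedCech.quasiIso_restrictMap`, hypothesis `LinkExact F J t` for
every set `t ≠ ∅` of vertices outside `J = e(ι')`: exactness of the AUGMENTED Čech complex of
`W_t` for the covering `(W_t ∩ W_j)_{j ∈ J}`, stated on raw functions `Finset ι → 𝕂`; proof by
the filtration of the kernel by the number of outside vertices). This file gives a second,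
independent route to the same comparison with hypotheses of a different shape, chosen so that
they are discharged verbatim by the acyclicity criterion of
`Literature/Algebra/Homology/OrderedCechAcyclic` (which speaks about `OrderedCech.complex` of a
monotone family, not about augmented complexes on raw functions):

* `OrderedCech.Cochain.restrictLE`, `OrderedCech.restrictMapLE e hle hF hG` — the restriction
  `Č•(F) → Č•(G)` to ANY monotone family `G` on `ι'` with `F (e t) ≤ G t` (for `G = F ∘ e`,
  `OrderedCech.comapFamily`, and `hle = le_rfl` this is definitionally the tree's
  `restrictMap e F hF`; the extra freedom in `G` is what makes the statements below apply to
  two Čech covers whose section modules over equal opens are only propositionally equal),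
  functorial in `e` (`restrictMapLE_comp`, `restrictMapLE_congr`) and an isomorphism for `e`
  surjective onto an equal family (`isIso_restrictMapLE`);
* `OrderedCech.quasiIso_restrictMapLE_of_deletion` — **deleting ONE member**: if `e` misses
  exactly one index `v`, `G t = F (e t)`, (H0) `⋂_{i'} F {e i', v} ⊆ F {v}` and (H1) the ordered
  Čech complex of the monotone family `t ↦ F (e(t) ∪ {v})` on `ι'` (`insFamily`: the sections of
  `𝓕|_{W_v}` on the covering `(W_v ∩ W_{e i'})_{i'}` of `W_v`) is exact in all degrees `≥ 1`, then
  `Č•(F) → Č•(G)` is a quasi-isomorphism. (H0)+(H1) is the exactness of the augmented complex of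
  the link of `t = {v}` in the language of `OrderedCechRestrict`, split into its degree-`0` part
  (a sheaf-axiom statement) and the non-augmented complex (`HomologicalComplex.ExactAt`);
* `OrderedCech.quasiIso_restrictMapLE_of_forall` — **deleting several members** by induction on
  their number (reindexing `ι ∖ {v} ≅ {i // i ≠ v}` along order isomorphisms): the restriction
  is a quasi-isomorphism as soon as (H0) and (H1) hold for every `v ∉ e(ι')` and every set of
  indices `S ∌ v` containing `e(ι')`, for the family `t ↦ F (t ∪ {v})`, `t ⊆ S`. Links of sets `t`
  with `#t ≥ 2` never occur: the price is that `S` varies. For `F s = Γ(W_s, 𝒪_Y(D))` these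
  hypotheses are Görtz–Wedhorn II, Lemma 22.1 on the affine `W_v` for the covers
  `(W_v ∩ W_a)_{a ∈ S}` (`Motives/AffineCechAcyclic`), and the comparison of two Čech covers
  follows by comparing both with their union (`Motives/CechCoverIndependence`), which is how the
  finiteness of the Čech cohomology of `𝒪(D)` for ONE affine covering of `X ×_K T` (Serre) gives
  it for ALL (`Motives/CechComplexPseudoCoherentDescent`, hypothesis of
  `cechComplex_pseudoCoherent_general_of_finite_cohomology`).

Neither hypothesis set is literally a special case of the other (augmented link complexes of all
outside sets `t` for the fixed `J`, versus non-augmented complexes plus `Ȟ⁰` for single vertices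
and all `S ⊇ J`); both follow from the acyclicity of quasi-coherent modules on affines, and both
give Thm. 22.9. The proof here is the direct cochain argument (no filtration, no spectral
sequence): the restriction is surjective in each degree (`restrict_extend`, extension by zero)
and its kernel is the complex of cochains vanishing off `v` (`VanishesOff`,
`vanishesOff_iff_restrict_eq_zero`); a cocycle `g` of that kernel of degree `m + 1` transfers to
the cocycle `γ_t = c(t) g_{e(t) ∪ v}` of degree `m` of `t ↦ F (e(t) ∪ {v})` (`Cochain.gammaOf`,
`d_gammaOf`; `c(t) = Π_{a ∈ t} δ(a)`, `δ(a) = ±1` according as `v < e a`, accounts for the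
position of `v` in `e(t) ∪ {v}`: `sign_insert_map`), a primitive `β` of `γ` (exactness, resp. the
`Ȟ⁰` hypothesis in degree `m = 0`) lifts back to the cone cochain `h_{e(t) ∪ v} = c(t) β_t` with
`d h = g` (`Cochain.coneLift`, `d_coneLift_eq`), and in degree `0` the kernel has no cocycles
(`eq_zero_of_vanishesOff_zero`); so the kernel complex is acyclic and the elementwise criterion
`quasiIso_of_surj_inj` (`Literature/Algebra/Homology/FiniteFreeResolution`) applies. Everything
is proved; no named facts. From this tree: `OrderedCech.Simplex.map`, `sign_map`, `comapFamily`,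
`Cochain.ext0_zero` (`OrderedCechRestrict`), `Cochain.ext0_mem` (`OrderedCechContraction`).
Mathlib searched (pin): `CategoryTheory/Sites/SheafCohomology/Cech` (the full Čech complex
functor of a presheaf; no refinement maps, no comparison of coverings), `Finset.preimage`,
`Finset.map_erase`, `Finset.filter_insert`, `Finset.erase_insert_of_ne`, `Finset.mul_prod_erase`,
`ConcreteCategory.isIso_iff_bijective`, `HomologicalComplex.Hom.isIso_of_components`,
`HomologicalComplex.ExactAt.of_iso`, `OrderEmbedding.ofMapLEIff`,
`Fintype.bijective_iff_injective_and_card` (used).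

## References

* U. Görtz, T. Wedhorn, *Algebraic Geometry II: Cohomology of Schemes*, Springer Spektrum (2023),
  doi:10.1007/978-3-658-43031-3: (21.16), Def. 21.71, Lemma 21.72, pp. 260–261; Cor. 21.81,
  Cor. 21.82 (Leray), p. 266; Lemma 22.1, p. 327; Thm. 22.2, p. 328; Thm. 22.9, p. 332 (read
  via the held copy, PDF pp. 258–266, 327–333). [GortzWedhorn2023]
* The Stacks Project, Tags 09UY (refinements), 03F7 (acyclic coverings compute cohomology),
  01X8–01XD (Čech cohomology of quasi-coherent modules; Čech cohomology of separated schemes and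
  affine coverings), 0G6T (contractible ordered Čech complexes). [StacksProject]
* J.-P. Serre, *Faisceaux algébriques cohérents*, Ann. of Math. 61 (1955), n° 29 (comparison of
  coverings via acyclicity).
-/

noncomputable section

universe u v

open CategoryTheory Finset

namespace Literature.Algebra.Homology

namespace OrderedCech

variable {ι ι' ι'' : Type} [LinearOrder ι] [LinearOrder ι'] [LinearOrder ι'']
variable {A : Type u} [CommRing A] {𝕂 : Type v} [AddCommGroup 𝕂] [Module A 𝕂]

/-! ### Generalities on cochains extended by zero -/

section Ext0

variable {F : Finset ι → Submodule A 𝕂}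

/-- Off the `n`-simplices the extension by zero vanishes. [folklore] -/
theorem Cochain.ext0_of_not {n : ℤ} (g : Cochain F n) (s : Finset ι)
    (h : ¬(s.Nonempty ∧ (s.card : ℤ) = n + 1)) : g.ext0 s = 0 := by
  unfold Cochain.ext0
  rw [dif_neg h]

/-- `ext0` is compatible with subtraction. [folklore] -/
theorem Cochain.ext0_sub {n : ℤ} (g g' : Cochain F n) (s : Finset ι) :
    (g - g').ext0 s = g.ext0 s - g'.ext0 s := by
  rw [sub_eq_add_neg, Cochain.ext0_add, ← neg_one_smul A g', Cochain.ext0_smul, neg_one_smul,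
    ← sub_eq_add_neg]

/-- Two cochains with the same extension by zero are equal. [folklore] -/
theorem Cochain.ext_of_ext0_simplex {n : ℤ} {g g' : Cochain F n} (h : ∀ s : Finset ι, s.Nonempty →
    (s.card : ℤ) = n + 1 → g.ext0 s = g'.ext0 s) : g = g' := by
  funext σ
  apply Subtype.ext
  rw [← Cochain.ext0_val g σ, ← Cochain.ext0_val g' σ]
  exact h σ.1 σ.2.1 σ.2.2

/-- A cochain vanishes iff its extension by zero vanishes on all simplices. [folklore] -/
theorem Cochain.eq_zero_iff_ext0 {n : ℤ} (g : Cochain F n) :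
    g = 0 ↔ ∀ s : Finset ι, s.Nonempty → (s.card : ℤ) = n + 1 → g.ext0 s = 0 := by
  constructor
  · rintro rfl s - -
    exact Cochain.ext0_zero s
  · intro h
    exact Cochain.ext_of_ext0_simplex fun s hs hc => by rw [h s hs hc, Cochain.ext0_zero]

/-- The differentials of `complex F hF` on elements, for any pair of consecutive degrees.
[folklore] -/
theorem complex_d_apply_eq_zero_iff (hF : Monotone F) {i j : ℤ} (hij : i + 1 = j)
    (x : Cochain F i) : ((complex F hF).d i j).hom x = 0 ↔ d F hF i x = 0 := by
  subst hij
  rw [complex_d]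
  rfl

/-- A cochain from a function on all finite subsets of `ι` with values in the right members (only
its values on the `n`-simplices matter). [folklore] -/
def Cochain.ofFun (n : ℤ) (f : Finset ι → 𝕂)
    (hf : ∀ s : Finset ι, s.Nonempty → (s.card : ℤ) = n + 1 → f s ∈ F s) : Cochain F n :=
  fun σ => ⟨f σ.1, hf σ.1 σ.2.1 σ.2.2⟩

/-- The extension by zero of `Cochain.ofFun n f`: `f` on the `n`-simplices, `0` elsewhere.
[folklore] -/
theorem Cochain.ext0_ofFun {n : ℤ} (f : Finset ι → 𝕂)
    (hf : ∀ s : Finset ι, s.Nonempty → (s.card : ℤ) = n + 1 → f s ∈ F s) (s : Finset ι) :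
    (Cochain.ofFun n f hf).ext0 s = if s.Nonempty ∧ (s.card : ℤ) = n + 1 then f s else 0 := by
  unfold Cochain.ext0 Cochain.ofFun
  split_ifs <;> rfl

end Ext0

/-! ### Simplices and signs along an order embedding -/

section Embedding

variable (e : ι' ↪o ι)

/-- Mapping simplices (`OrderedCech.Simplex.map` of
`Literature/Algebra/Homology/OrderedCechRestrict`) is compatible with composition of order
embeddings. [folklore] -/
theorem Simplex.map_trans (e' : ι'' ↪o ι') {n : ℤ} (τ : Simplex ι'' n) :
    Simplex.map (e'.trans e) τ = Simplex.map e (Simplex.map e' τ) :=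
  Subtype.ext (by simp only [Simplex.map_val, Finset.map_map]; rfl)

/-- A finite subset of `ι'` is a simplex iff its image is. [folklore] -/
theorem simplex_iff_map (n : ℤ) (t : Finset ι') :
    (t.Nonempty ∧ (t.card : ℤ) = n + 1) ↔
      ((t.map e.toEmbedding).Nonempty ∧ ((t.map e.toEmbedding).card : ℤ) = n + 1) := by
  rw [Finset.map_nonempty, Finset.card_map]

/-- The pullback `e⁻¹(s)` of a finite subset of `ι`. [folklore] -/
def pre (s : Finset ι) : Finset ι' := s.preimage e e.injective.injOn

/-- Membership in the pullback. [folklore] -/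
@[simp] theorem mem_pre {s : Finset ι} {a : ι'} : a ∈ pre e s ↔ e a ∈ s := by
  unfold pre
  rw [Finset.mem_preimage]

/-- `e⁻¹(e(t)) = t`. [folklore] -/
@[simp] theorem pre_map (t : Finset ι') : pre e (t.map e.toEmbedding) = t := by
  ext a
  rw [mem_pre]
  exact Finset.mem_map' e.toEmbedding

/-- `e(e⁻¹(s)) = s` for `s` inside the range of `e`. [folklore] -/
theorem map_pre_of_subset (s : Finset ι) (hs : ∀ i ∈ s, i ∈ Set.range e) :
    (pre e s).map e.toEmbedding = s := by
  ext i
  rw [Finset.mem_map]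
  constructor
  · rintro ⟨a, ha, rfl⟩
    exact (mem_pre e).1 ha
  · intro hi
    obtain ⟨a, rfl⟩ := hs i hi
    exact ⟨a, (mem_pre e).2 hi, rfl⟩

end Embedding

/-! ### Restriction of cochains along an order embedding -/

section Restrict

variable (e : ι' ↪o ι) {F : Finset ι → Submodule A 𝕂} {G : Finset ι' → Submodule A 𝕂}
variable (hle : ∀ t : Finset ι', F (t.map e.toEmbedding) ≤ G t)

/-- **Restriction of cochains to a sub-family** along an order embedding `e : ι' ↪o ι` of index
sets: `(g|_e)_t = g_{e(t)}`, for families with `F (e t) ⊆ G t` (e.g. `G t = F (e t)`: the Čech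
complex of the sub-covering `(U_{e(i')})_{i'}`; Görtz–Wedhorn II, (21.16): a refinement map for
the map of coverings `i' ↦ e i'`). [cite: GortzWedhorn2023, (21.16) and Def. 21.71 (pp. 260–261)] -/
def Cochain.restrictLE (n : ℤ) : Cochain F n →ₗ[A] Cochain G n where
  toFun g τ := ⟨(g (Simplex.map e τ) : 𝕂), hle τ.1 (g (Simplex.map e τ)).2⟩
  map_add' g g' := by
    funext τ; rfl
  map_smul' a g := by
    funext τ; rfl

/-- The value of a restricted cochain. [folklore] -/
@[simp] theorem Cochain.coe_restrictLE_apply {n : ℤ} (g : Cochain F n) (τ : Simplex ι' n) :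
    ((Cochain.restrictLE e hle n g) τ : 𝕂) = g (Simplex.map e τ) := rfl

/-- Restriction and extension by zero: `(g|_e).ext0 t = g.ext0 (e t)`. [folklore] -/
theorem Cochain.ext0_restrictLE {n : ℤ} (g : Cochain F n) (t : Finset ι') :
    (Cochain.restrictLE e hle n g).ext0 t = g.ext0 (t.map e.toEmbedding) := by
  unfold Cochain.ext0
  by_cases h : t.Nonempty ∧ (t.card : ℤ) = n + 1
  · have h' := (simplex_iff_map e n t).1 h
    rw [dif_pos h, dif_pos h']
    rfl
  · rw [dif_neg h, dif_neg ((simplex_iff_map e n t).not.1 h)]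

variable (hF : Monotone F) (hG : Monotone G)

/-- **Restriction commutes with the Čech differential.** [folklore] -/
theorem d_restrictLE {n : ℤ} (g : Cochain F n) :
    d G hG n (Cochain.restrictLE e hle n g) = Cochain.restrictLE e hle (n + 1) (d F hF n g) := by
  funext τ
  apply Subtype.ext
  rw [coe_d_apply, Cochain.coe_restrictLE_apply, coe_d_apply, Simplex.map_val, Finset.sum_map]
  refine Finset.sum_congr rfl fun a _ => ?_
  rw [RelEmbedding.coe_toEmbedding, sign_map, Cochain.ext0_restrictLE, Finset.map_erase,
    RelEmbedding.coe_toEmbedding]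

/-- **The restriction morphism of ordered Čech complexes** `Č(F) → Č(G)` along `e : ι' ↪o ι`
(`F (e t) ⊆ G t`). [cite: GortzWedhorn2023, (21.16) (pp. 260–261)] -/
def restrictMapLE : complex F hF ⟶ complex G hG :=
  CochainComplex.ofHom (fun n => ModuleCat.ofHom (Cochain.restrictLE e hle n)) fun n => by
    rw [complex_d, complex_d]
    ext g
    exact d_restrictLE e hle hF hG g

/-- The components of `restrictMapLE`. [folklore] -/
@[simp] theorem restrictMapLE_f (n : ℤ) :
    (restrictMapLE e hle hF hG).f n = ModuleCat.ofHom (Cochain.restrictLE e hle n) := rfl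

/-- For `G = F ∘ e` the restriction `restrictMapLE` is the tree's `OrderedCech.restrictMap`
(`Literature/Algebra/Homology/OrderedCechRestrict`), definitionally. [folklore] -/
theorem restrictMapLE_eq_restrictMap :
    restrictMapLE e (fun _ => le_rfl) hF (comapFamily_mono e hF) = restrictMap e F hF := rfl

/-- `restrictMapLE` only depends on the underlying map of `e`. [folklore] -/
theorem restrictMapLE_congr {e'' : ι' ↪o ι} (h : ∀ i, e i = e'' i)
    (hle'' : ∀ t : Finset ι', F (t.map e''.toEmbedding) ≤ G t) :
    restrictMapLE e hle hF hG = restrictMapLE e'' hle'' hF hG := by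
  obtain rfl : e = e'' := DFunLike.ext _ _ h
  rfl

/-- **Functoriality**: restricting along `e' ≫ e` is restricting along `e`, then along `e'`.
[folklore] -/
theorem restrictMapLE_comp (e' : ι'' ↪o ι') {H : Finset ι'' → Submodule A 𝕂} (hH : Monotone H)
    (hle' : ∀ t : Finset ι'', G (t.map e'.toEmbedding) ≤ H t)
    (hle'' : ∀ t : Finset ι'', F (t.map (e'.trans e).toEmbedding) ≤ H t) :
    restrictMapLE (e'.trans e) hle'' hF hH = restrictMapLE e hle hF hG ≫ restrictMapLE e' hle' hG hH := by
  ext n g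
  change Cochain.restrictLE (e'.trans e) hle'' n g =
    Cochain.restrictLE e' hle' n (Cochain.restrictLE e hle n g)
  funext τ
  apply Subtype.ext
  simp only [Cochain.coe_restrictLE_apply]
  rw [Simplex.map_trans]

/-- **Restriction along a surjective order embedding (an order isomorphism) onto an equal family
is an isomorphism of complexes.** [folklore] -/
theorem isIso_restrictMapLE (hsurj : Function.Surjective e)
    (heq : ∀ t : Finset ι', F (t.map e.toEmbedding) = G t) : IsIso (restrictMapLE e hle hF hG) := by
  have hbij : ∀ n, Function.Bijective (Cochain.restrictLE e hle n) := by
    intro n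
    have hpre : ∀ s : Finset ι, (pre e s).map e.toEmbedding = s := fun s =>
      map_pre_of_subset e s fun i _ => hsurj i
    constructor
    · intro g g' h
      apply Cochain.ext_of_ext0_simplex
      intro s hs hc
      have := congrArg (fun c : Cochain G n => c.ext0 (pre e s)) h
      simp only [Cochain.ext0_restrictLE, hpre] at this
      exact this
    · intro z
      refine ⟨Cochain.ofFun n (fun s => z.ext0 (pre e s)) fun s _ _ => ?_, ?_⟩
      · have h1 : G (pre e s) ≤ F s := by
          rw [← heq, hpre]
        exact h1 (z.ext0_mem _)
      · apply Cochain.ext_of_ext0_simplex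
        intro t ht hc
        rw [Cochain.ext0_restrictLE, Cochain.ext0_ofFun, if_pos ((simplex_iff_map e n t).1 ⟨ht, hc⟩),
          pre_map]
  haveI : ∀ n, IsIso ((restrictMapLE e hle hF hG).f n) := fun n => by
    rw [restrictMapLE_f]
    exact (ConcreteCategory.isIso_iff_bijective _).2 (hbij n)
  exact HomologicalComplex.Hom.isIso_of_components _

end Restrict

/-! ### Deleting one member of the covering -/

section Deletion

variable {F : Finset ι → Submodule A 𝕂}

/-- **The family `t ↦ F (e(t) ∪ {v})`** on the smaller index set — for `F s = Γ(W_s, 𝓕)` these are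
the sections `Γ(W_v ∩ W_{e(t)}, 𝓕)` over the intersections of the members of the covering
`(W_v ∩ W_{e(i')})_{i'}` of `W_v`, whose ordered Čech complex controls the deletion of the member
`W_v`. [folklore] -/
def insFamily (e : ι' ↪o ι) (v : ι) (F : Finset ι → Submodule A 𝕂) : Finset ι' → Submodule A 𝕂 :=
  fun t => F (insert v (t.map e.toEmbedding))

/-- The members of `insFamily`. [folklore] -/
theorem insFamily_apply (e : ι' ↪o ι) (v : ι) (t : Finset ι') :
    insFamily e v F t = F (insert v (t.map e.toEmbedding)) := rfl

/-- `insFamily` is monotone when `F` is. [folklore] -/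
theorem insFamily_mono (e : ι' ↪o ι) (v : ι) (hF : Monotone F) : Monotone (insFamily e v F) :=
  fun _ _ h => hF (Finset.insert_subset_insert v (Finset.map_subset_map.2 h))

/-- The sign `δ(a) = -1` if `v < e a`, `+1` otherwise: inserting `v` shifts the position of `e a`
in a simplex exactly when `v < e a`. [folklore] -/
def delta (A : Type u) [CommRing A] (e : ι' ↪o ι) (v : ι) (a : ι') : A := if v < e a then -1 else 1

/-- `δ(a)² = 1`. [folklore] -/
theorem delta_mul_self (e : ι' ↪o ι) (v : ι) (a : ι') : delta A e v a * delta A e v a = 1 := by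
  unfold delta
  split_ifs <;> simp

/-- The sign `c(t) = Π_{a ∈ t} δ(a) = (-1)^{#{a ∈ t ; v < e a}}` relating the Čech differential on
the simplices `e(t) ∪ {v}` of `ι` to the Čech differential on the simplices `t` of `ι'`.
[folklore] -/
def csign (A : Type u) [CommRing A] (e : ι' ↪o ι) (v : ι) (t : Finset ι') : A :=
  ∏ a ∈ t, delta A e v a

/-- `c(t) = δ(a) c(t ∖ a)` for `a ∈ t`. [folklore] -/
theorem csign_eq_mul_erase (e : ι' ↪o ι) (v : ι) {t : Finset ι'} {a : ι'} (ha : a ∈ t) :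
    csign A e v t = delta A e v a * csign A e v (t.erase a) :=
  (Finset.mul_prod_erase t _ ha).symm

/-- `c(t)² = 1`. [folklore] -/
theorem csign_mul_self (e : ι' ↪o ι) (v : ι) (t : Finset ι') : csign A e v t * csign A e v t = 1 := by
  unfold csign
  rw [← Finset.prod_mul_distrib]
  exact Finset.prod_eq_one fun a _ => delta_mul_self e v a

section Range

variable (e : ι' ↪o ι) (v : ι) (hv : ∀ i, i ∈ Set.range e ↔ i ≠ v)
include hv

/-- `e a ≠ v`. [folklore] -/
theorem apply_ne_of_range (a : ι') : e a ≠ v := (hv (e a)).1 ⟨a, rfl⟩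

/-- `v ∉ e(t)`. [folklore] -/
theorem not_mem_map_of_range (t : Finset ι') : v ∉ t.map e.toEmbedding := fun h => by
  obtain ⟨a, -, ha⟩ := Finset.mem_map.1 h
  exact apply_ne_of_range e v hv a ha

/-- `e(e⁻¹(s)) = s` for `v ∉ s`. [folklore] -/
theorem map_pre_of_not_mem {s : Finset ι} (hs : v ∉ s) : (pre e s).map e.toEmbedding = s :=
  map_pre_of_subset e s fun i hi => (hv i).2 fun h => hs (h ▸ hi)

/-- `e(e⁻¹(s ∖ v)) ∪ {v} = s` for `v ∈ s`. [folklore] -/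
theorem insert_map_pre_erase {s : Finset ι} (hs : v ∈ s) :
    insert v ((pre e (s.erase v)).map e.toEmbedding) = s := by
  rw [map_pre_of_subset e (s.erase v) fun i hi => (hv i).2 (Finset.ne_of_mem_erase hi),
    Finset.insert_erase hs]

/-- `#(e(t) ∪ {v}) = #t + 1`. [folklore] -/
theorem card_insert_map (t : Finset ι') : (insert v (t.map e.toEmbedding)).card = t.card + 1 := by
  rw [Finset.card_insert_of_notMem (not_mem_map_of_range e v hv t), Finset.card_map]

/-- `(e(t) ∪ {v}) ∖ v = e(t)`. [folklore] -/
theorem erase_insert_map (t : Finset ι') :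
    (insert v (t.map e.toEmbedding)).erase v = t.map e.toEmbedding :=
  Finset.erase_insert (not_mem_map_of_range e v hv t)

/-- `(e(t) ∪ {v}) ∖ e a = e(t ∖ a) ∪ {v}`. [folklore] -/
theorem erase_insert_map_apply (t : Finset ι') (a : ι') :
    (insert v (t.map e.toEmbedding)).erase (e a) = insert v ((t.erase a).map e.toEmbedding) := by
  rw [Finset.erase_insert_of_ne (apply_ne_of_range e v hv a).symm, Finset.map_erase,
    RelEmbedding.coe_toEmbedding]

/-- **The sign of the face opposite `e a` in `e(t) ∪ {v}` is `δ(a)` times the sign of the face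
opposite `a` in `t`.** [folklore] -/
theorem sign_insert_map (t : Finset ι') (a : ι') :
    sign A (insert v (t.map e.toEmbedding)) (e a) = delta A e v a * sign A t a := by
  have hsT : sign A (t.map e.toEmbedding) (e a) = sign A t a := sign_map e t a
  unfold delta
  unfold sign at hsT ⊢
  rw [Finset.filter_insert]
  split_ifs with h
  · rw [Finset.card_insert_of_notMem fun hm =>
      not_mem_map_of_range e v hv t (Finset.mem_of_mem_filter _ hm), pow_succ, hsT]
    ring
  · rw [hsT, one_mul]

end Range

/-- **Cochains vanishing off `v`**: `g_s = 0` unless `v ∈ s` — the kernel of the restriction to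
the sub-family indexed by `ι ∖ {v}` (`vanishesOff_iff_restrict_eq_zero`). [folklore] -/
def VanishesOff (v : ι) {n : ℤ} (g : Cochain F n) : Prop := ∀ s : Finset ι, v ∉ s → g.ext0 s = 0

/-- The zero cochain vanishes off `v`. [folklore] -/
theorem vanishesOff_zero (v : ι) (n : ℤ) : VanishesOff v (0 : Cochain F n) := fun s _ =>
  Cochain.ext0_zero s

/-- Differences of cochains vanishing off `v` vanish off `v`. [folklore] -/
theorem VanishesOff.sub {v : ι} {n : ℤ} {g g' : Cochain F n} (hg : VanishesOff v g)
    (hg' : VanishesOff v g') : VanishesOff v (g - g') := fun s hs => by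
  rw [Cochain.ext0_sub, hg s hs, hg' s hs, sub_zero]

section Kernel

variable (e : ι' ↪o ι) (v : ι) (hv : ∀ i, i ∈ Set.range e ↔ i ≠ v)
  {G : Finset ι' → Submodule A 𝕂} (hle : ∀ t : Finset ι', F (t.map e.toEmbedding) ≤ G t)
include hv

/-- Off `v`, a cochain is determined by its restriction: `g.ext0 s = (g|_e).ext0 (e⁻¹ s)`.
[folklore] -/
theorem ext0_eq_ext0_restrict_pre {n : ℤ} (g : Cochain F n) {s : Finset ι} (hs : v ∉ s) :
    g.ext0 s = (Cochain.restrictLE e hle n g).ext0 (pre e s) := by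
  rw [Cochain.ext0_restrictLE, map_pre_of_not_mem e v hv hs]

/-- A cochain vanishing off `v` restricts to zero. [folklore] -/
theorem restrict_eq_zero_of_vanishesOff {n : ℤ} {g : Cochain F n} (hg : VanishesOff v g) :
    Cochain.restrictLE e hle n g = 0 := by
  apply Cochain.ext_of_ext0_simplex
  intro t _ _
  rw [Cochain.ext0_restrictLE, Cochain.ext0_zero]
  exact hg _ (not_mem_map_of_range e v hv t)

/-- **The kernel of the restriction consists of the cochains vanishing off `v`.** [folklore] -/
theorem vanishesOff_of_restrict_eq_zero {n : ℤ} {g : Cochain F n}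
    (hg : Cochain.restrictLE e hle n g = 0) : VanishesOff v g := fun s hs => by
  rw [ext0_eq_ext0_restrict_pre e v hv hle g hs, hg, Cochain.ext0_zero]

/-- `g` vanishes off `v` iff its restriction vanishes. [folklore] -/
theorem vanishesOff_iff_restrict_eq_zero {n : ℤ} (g : Cochain F n) :
    VanishesOff v g ↔ Cochain.restrictLE e hle n g = 0 :=
  ⟨restrict_eq_zero_of_vanishesOff e v hv hle, vanishesOff_of_restrict_eq_zero e v hv hle⟩

omit hle in
/-- The differential of a cochain vanishing off `v` vanishes off `v` (the restriction is a
morphism of complexes). [folklore] -/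
theorem VanishesOff.d (hF : Monotone F) {n : ℤ} {g : Cochain F n} (hg : VanishesOff v g) :
    VanishesOff v (d F hF n g) :=
  vanishesOff_of_restrict_eq_zero e v hv (G := comapFamily e F) (fun _ => le_rfl) (by
    rw [← d_restrictLE e _ hF (comapFamily_mono e hF), restrict_eq_zero_of_vanishesOff e v hv _ hg,
      map_zero])

variable (heq : ∀ t : Finset ι', F (t.map e.toEmbedding) = G t)

/-- **Extension by zero** of a cochain of the sub-family to a cochain of `F` vanishing on all
simplices through `v` (a set-theoretic section of the restriction, `restrict_extend`).
[folklore] -/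
def Cochain.extend (n : ℤ) (z : Cochain G n) : Cochain F n :=
  Cochain.ofFun n (fun s => if v ∈ s then 0 else z.ext0 (pre e s)) fun s _ _ => by
    split_ifs with h
    · exact zero_mem _
    · have h1 : G (pre e s) ≤ F s := by rw [← heq, map_pre_of_not_mem e v hv h]
      exact h1 (z.ext0_mem _)

/-- The values of the extension by zero. [folklore] -/
theorem Cochain.ext0_extend {n : ℤ} (z : Cochain G n) (s : Finset ι) :
    (Cochain.extend e v hv heq n z).ext0 s = if v ∈ s then 0 else z.ext0 (pre e s) := by
  rw [Cochain.extend, Cochain.ext0_ofFun]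
  split_ifs with h1 h2 h3
  · rfl
  · rfl
  · rfl
  · symm
    apply z.ext0_of_not
    rw [simplex_iff_map e, map_pre_of_not_mem e v hv h3]
    exact h1

/-- Restricting the extension by zero gives back the cochain. [folklore] -/
theorem restrict_extend {n : ℤ} (z : Cochain G n) :
    Cochain.restrictLE e hle n (Cochain.extend e v hv heq n z) = z := by
  apply Cochain.ext_of_ext0_simplex
  intro t _ _
  rw [Cochain.ext0_restrictLE, Cochain.ext0_extend, if_neg (not_mem_map_of_range e v hv t), pre_map]

end Kernel

section Cone

variable (e : ι' ↪o ι) (v : ι) (hv : ∀ i, i ∈ Set.range e ↔ i ≠ v)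
include hv

/-- **The cone construction**: from values `b(t) ∈ F (e(t) ∪ {v})` on the subsets of `ι'`, the
cochain of `F` supported on the simplices through `v` with `h_{e(t) ∪ v} = c(t) b(t)`. [folklore] -/
def Cochain.coneLift (m : ℤ) (b : Finset ι' → 𝕂)
    (hb : ∀ t : Finset ι', b t ∈ F (insert v (t.map e.toEmbedding))) : Cochain F m :=
  Cochain.ofFun m
    (fun s => if v ∈ s then csign A e v (pre e (s.erase v)) • b (pre e (s.erase v)) else 0)
    fun s _ _ => by
      split_ifs with h
      · have h1 : F (insert v ((pre e (s.erase v)).map e.toEmbedding)) ≤ F s :=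
          le_of_eq (congrArg F (insert_map_pre_erase e v hv h))
        exact h1 (Submodule.smul_mem _ _ (hb _))
      · exact zero_mem _

/-- The cone cochain vanishes off `v`. [folklore] -/
theorem vanishesOff_coneLift (m : ℤ) (b : Finset ι' → 𝕂)
    (hb : ∀ t : Finset ι', b t ∈ F (insert v (t.map e.toEmbedding))) :
    VanishesOff v (Cochain.coneLift e v hv m b hb) := fun s hs => by
  rw [Cochain.coneLift, Cochain.ext0_ofFun, if_neg hs]
  split_ifs <;> rfl

/-- The values of the cone cochain on the simplices through `v`. [folklore] -/
theorem ext0_coneLift_insert (m : ℤ) (b : Finset ι' → 𝕂)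
    (hb : ∀ t : Finset ι', b t ∈ F (insert v (t.map e.toEmbedding))) (t : Finset ι')
    (ht : (t.card : ℤ) = m) :
    (Cochain.coneLift e v hv m b hb).ext0 (insert v (t.map e.toEmbedding)) = csign A e v t • b t := by
  rw [Cochain.coneLift, Cochain.ext0_ofFun, if_pos ⟨Finset.insert_nonempty _ _, by
    rw [card_insert_map e v hv t]; push_cast; omega⟩, if_pos (Finset.mem_insert_self _ _),
    erase_insert_map e v hv, pre_map]

variable (hF : Monotone F)

/-- **The differential of the cone cochain on a simplex through `v`** is `c(t)` times the Čech
differential of `b` on `ι'`: `(d h)_{e(t) ∪ v} = c(t) Σ_{a ∈ t} ε(t, a) b(t ∖ a)` (the face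
opposite `v` does not contribute, and `ε(e(t) ∪ v, e a) c(t ∖ a) = ε(t, a) c(t)`). [folklore] -/
theorem ext0_d_coneLift_insert (m : ℤ) (hm : 0 ≤ m) (b : Finset ι' → 𝕂)
    (hb : ∀ t : Finset ι', b t ∈ F (insert v (t.map e.toEmbedding))) (t : Finset ι')
    (ht : (t.card : ℤ) = m + 1) :
    (d F hF m (Cochain.coneLift e v hv m b hb)).ext0 (insert v (t.map e.toEmbedding)) =
      csign A e v t • ∑ a ∈ t, sign A t a • b (t.erase a) := by
  rw [ext0_d F hF m _ _ (by rw [card_insert_map e v hv t]; omega),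
    Finset.sum_insert (not_mem_map_of_range e v hv t), erase_insert_map e v hv,
    vanishesOff_coneLift e v hv m b hb _ (not_mem_map_of_range e v hv t), smul_zero, zero_add,
    Finset.sum_map, Finset.smul_sum]
  refine Finset.sum_congr rfl fun a ha => ?_
  rw [RelEmbedding.coe_toEmbedding, erase_insert_map_apply e v hv t a,
    ext0_coneLift_insert e v hv m b hb (t.erase a)
      (by have h1 := Finset.card_erase_add_one ha; omega),
    sign_insert_map e v hv, smul_smul, smul_smul, csign_eq_mul_erase e v ha]
  congr 1
  ring

/-- **`d` of a cone cochain**: if `(d h)_{e(t) ∪ v}` agrees with `g` on all simplices through `v`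
and `g` vanishes off `v`, then `d h = g`. [folklore] -/
theorem d_coneLift_eq (m : ℤ) (hm : 0 ≤ m) (b : Finset ι' → 𝕂)
    (hb : ∀ t : Finset ι', b t ∈ F (insert v (t.map e.toEmbedding))) (g : Cochain F (m + 1))
    (hg : VanishesOff v g)
    (h : ∀ t : Finset ι', (t.card : ℤ) = m + 1 →
      csign A e v t • ∑ a ∈ t, sign A t a • b (t.erase a) =
        g.ext0 (insert v (t.map e.toEmbedding))) :
    d F hF m (Cochain.coneLift e v hv m b hb) = g := by
  apply Cochain.ext_of_ext0_simplex
  intro s _ hc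
  by_cases hs : v ∈ s
  · have ht : ((pre e (s.erase v)).card : ℤ) = m + 1 := by
      have h1 := congrArg Finset.card (insert_map_pre_erase e v hv hs)
      rw [card_insert_map e v hv] at h1
      omega
    rw [← insert_map_pre_erase e v hv hs, ext0_d_coneLift_insert e v hv hF m hm b hb _ ht, h _ ht]
  · rw [hg s hs, (vanishesOff_coneLift e v hv m b hb).d e v hv hF s hs]

/-- **The transferred cochain**: for a cochain `g` of degree `m + 1` of `F`, the cochain
`γ_t = c(t) g_{e(t) ∪ v}` of degree `m` of the family `t ↦ F (e(t) ∪ {v})`. [folklore] -/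
def Cochain.gammaOf (m : ℤ) (g : Cochain F (m + 1)) : Cochain (insFamily e v F) m :=
  Cochain.ofFun m (fun t => csign A e v t • g.ext0 (insert v (t.map e.toEmbedding)))
    fun _ _ _ => Submodule.smul_mem _ _ (g.ext0_mem _)

omit hF in
/-- The values of the transferred cochain. [folklore] -/
theorem ext0_gammaOf (m : ℤ) (hm : 0 ≤ m) (g : Cochain F (m + 1)) (t : Finset ι') :
    (Cochain.gammaOf e v m g).ext0 t = csign A e v t • g.ext0 (insert v (t.map e.toEmbedding)) := by
  rw [Cochain.gammaOf, Cochain.ext0_ofFun]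
  split_ifs with h
  · rfl
  · rw [g.ext0_of_not, smul_zero]
    rintro ⟨-, hc⟩
    apply h
    rw [card_insert_map e v hv] at hc
    push_cast at hc
    exact ⟨Finset.card_pos.1 (by omega), by omega⟩

/-- **A cocycle of `F` vanishing off `v` transfers to a cocycle of `t ↦ F (e(t) ∪ {v})`**: the
cocycle condition of `g` on `e(t) ∪ {v}` loses its face opposite `v` (where `g` vanishes) and the
remaining faces are those of `t`, with signs corrected by `c`. [folklore] -/
theorem d_gammaOf (m : ℤ) (hm : 0 ≤ m) (g : Cochain F (m + 1)) (hg : VanishesOff v g)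
    (hdg : d F hF (m + 1) g = 0) :
    d (insFamily e v F) (insFamily_mono e v hF) m (Cochain.gammaOf e v m g) = 0 := by
  rw [Cochain.eq_zero_iff_ext0]
  intro t _ hc
  rw [ext0_d _ _ m _ t (by omega)]
  -- the cocycle condition of `g` on `e(t) ∪ {v}`
  have key := congrArg (fun c : Cochain F (m + 1 + 1) => c.ext0 (insert v (t.map e.toEmbedding)))
    hdg
  simp only [Cochain.ext0_zero] at key
  rw [ext0_d F hF (m + 1) g _ (by rw [card_insert_map e v hv]; omega),
    Finset.sum_insert (not_mem_map_of_range e v hv t), erase_insert_map e v hv,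
    hg _ (not_mem_map_of_range e v hv t), smul_zero, zero_add, Finset.sum_map] at key
  have key' : ∑ a ∈ t, (delta A e v a * sign A t a) •
      g.ext0 (insert v ((t.erase a).map e.toEmbedding)) = 0 := by
    rw [← key]
    refine Finset.sum_congr rfl fun a _ => ?_
    rw [RelEmbedding.coe_toEmbedding, sign_insert_map e v hv, erase_insert_map_apply e v hv]
  calc ∑ a ∈ t, sign A t a • (Cochain.gammaOf e v m g).ext0 (t.erase a)
      = ∑ a ∈ t, csign A e v t • ((delta A e v a * sign A t a) •
          g.ext0 (insert v ((t.erase a).map e.toEmbedding))) := by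
        refine Finset.sum_congr rfl fun a ha => ?_
        rw [ext0_gammaOf e v hv m hm, smul_smul, smul_smul, csign_eq_mul_erase e v ha]
        congr 1
        rw [show delta A e v a * csign A e v (t.erase a) * (delta A e v a * sign A t a) =
          delta A e v a * delta A e v a * (csign A e v (t.erase a) * sign A t a) by ring,
          delta_mul_self, one_mul, mul_comm]
    _ = csign A e v t • ∑ a ∈ t, (delta A e v a * sign A t a) •
          g.ext0 (insert v ((t.erase a).map e.toEmbedding)) := (Finset.smul_sum ..).symm
    _ = 0 := by rw [key', smul_zero]

/-- **The kernel complex in degree `0`**: a `0`-cocycle of `F` vanishing off `v` is zero (its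
values agree on all vertices, and vanish on the vertices `e i' ≠ v`). [folklore] -/
theorem eq_zero_of_vanishesOff_zero [Nonempty ι'] (g : Cochain F 0) (hg : VanishesOff v g)
    (hdg : d F hF 0 g = 0) : g = 0 := by
  obtain ⟨a⟩ := ‹Nonempty ι'›
  have hall := (d_zero_eq_zero_iff F hF g).1 hdg
  have h0 : (g (vertex (e a)) : 𝕂) = 0 := by
    rw [← Cochain.ext0_val]
    exact hg _ (Finset.notMem_singleton.2 (apply_ne_of_range e v hv a).symm)
  funext σ
  apply Subtype.ext
  obtain ⟨i, rfl⟩ := exists_eq_vertex σ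
  rw [hall i (e a), h0]
  rfl

/-- **The kernel complex in degree `1`**: a `1`-cocycle `g` of `F` vanishing off `v` is `d h` for
a `0`-cochain `h` vanishing off `v`, provided `⋂_{i'} F {e i', v} ⊆ F {v}` (for sections of a
sheaf: an element lying in all `Γ(W_v ∩ W_{e i'})` lies in `Γ(W_v)`, the `W_{e i'}` covering `W_v`).
The transferred `0`-cocycle `γ` is constant, `γ_{i'} = x ∈ ⋂_{i'} F {e i', v}`, and
`h_v = x`. [folklore] -/
theorem exists_d_eq_of_vanishesOff_one [Nonempty ι']
    (H0 : (⨅ a : ι', F (insert v {e a})) ≤ F {v}) (g : Cochain F (0 + 1))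
    (hg : VanishesOff v g) (hdg : d F hF (0 + 1) g = 0) :
    ∃ h : Cochain F 0, VanishesOff v h ∧ d F hF 0 h = g := by
  obtain ⟨a₀⟩ := ‹Nonempty ι'›
  set γ := Cochain.gammaOf e v 0 g with hγ_def
  have hdγ : d (insFamily e v F) (insFamily_mono e v hF) 0 γ = 0 := d_gammaOf e v hv hF 0 le_rfl g hg hdg
  have hall := (d_zero_eq_zero_iff _ (insFamily_mono e v hF) γ).1 hdγ
  set x : 𝕂 := (γ (vertex a₀) : 𝕂) with hx_def
  -- `x = γ_{a} = δ(a) g_{v, e a}` for every `a`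
  have hxa : ∀ a : ι', x = delta A e v a • g.ext0 (insert v {e a}) := fun a => by
    rw [hx_def, hall a₀ a, ← Cochain.ext0_val, vertex_val, ext0_gammaOf e v hv 0 le_rfl,
      Finset.map_singleton]
    unfold csign
    rw [Finset.prod_singleton]
    rfl
  have hx : x ∈ F {v} := by
    apply H0
    rw [Submodule.mem_iInf]
    intro a
    rw [hxa a]
    exact Submodule.smul_mem _ _ (g.ext0_mem _)
  refine ⟨Cochain.coneLift e v hv 0 (fun _ => x) fun _ =>
    hF (Finset.singleton_subset_iff.2 (Finset.mem_insert_self _ _)) hx,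
    vanishesOff_coneLift e v hv 0 _ _, d_coneLift_eq e v hv hF 0 le_rfl _ _ g hg fun t ht => ?_⟩
  obtain ⟨a, rfl⟩ := Finset.card_eq_one.1 (by exact_mod_cast ht)
  rw [Finset.sum_singleton, Finset.map_singleton]
  unfold csign
  rw [Finset.prod_singleton, show sign A ({a} : Finset ι') a = 1 from ?_, one_smul]
  · change delta A e v a • x = g.ext0 (insert v {e a})
    rw [hxa a, smul_smul, delta_mul_self, one_smul]
  · unfold sign
    rw [show ({a} : Finset ι').filter (· < a) = ∅ from ?_, Finset.card_empty, pow_zero]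
    ext b
    simp only [Finset.mem_filter, Finset.mem_singleton, Finset.notMem_empty, iff_false, not_and]
    rintro rfl
    exact lt_irrefl _

/-- **The kernel complex in degrees `≥ 2`**: a cocycle `g` of degree `p + 2` of `F` vanishing off
`v` is `d h` for a cochain `h` vanishing off `v`, provided the ordered Čech complex of
`t ↦ F (e(t) ∪ {v})` is exact in degree `p + 1` (for sections of `𝓕`: the Čech complex of
`𝓕|_{W_v}` on the covering `(W_v ∩ W_{e i'})_{i'}` of `W_v`). The transferred cocycle `γ = d β`
and `h_{e(t) ∪ v} = c(t) β_t`. [folklore] -/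
theorem exists_d_eq_of_vanishesOff_succ (p : ℤ) (hp : 0 ≤ p)
    (H1 : Function.Exact (d (insFamily e v F) (insFamily_mono e v hF) p)
      (d (insFamily e v F) (insFamily_mono e v hF) (p + 1)))
    (g : Cochain F (p + 1 + 1)) (hg : VanishesOff v g) (hdg : d F hF (p + 1 + 1) g = 0) :
    ∃ h : Cochain F (p + 1), VanishesOff v h ∧ d F hF (p + 1) h = g := by
  have hdγ := d_gammaOf e v hv hF (p + 1) (by omega) g hg hdg
  obtain ⟨β, hβ⟩ := (H1 _).1 hdγ
  refine ⟨Cochain.coneLift e v hv (p + 1) (fun t => β.ext0 t) fun t => β.ext0_mem t,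
    vanishesOff_coneLift e v hv _ _ _, d_coneLift_eq e v hv hF (p + 1) (by omega) _ _ g hg
      fun t ht => ?_⟩
  rw [← ext0_d _ (insFamily_mono e v hF) p β t (by omega), hβ,
    ext0_gammaOf e v hv (p + 1) (by omega), smul_smul, csign_mul_self, one_smul]

end Cone

end Deletion

/-! ### Deleting one member of the covering is a quasi-isomorphism -/

section QuasiIso

variable {𝕃 : Type u} [AddCommGroup 𝕃] [Module A 𝕃] {F : Finset ι → Submodule A 𝕃}
  {G : Finset ι' → Submodule A 𝕃}

/-- **Deleting an acyclic member of the covering does not change Čech cohomology.** Let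
`e : ι' ↪o ι` miss exactly one index `v`, `F` a monotone family on `ι` and `G t = F (e t)` its
restriction to `ι'`. Suppose that `⋂_{i'} F {e i', v} ⊆ F {v}` and that the ordered Čech complex
of `t ↦ F (e(t) ∪ {v})` is exact in all degrees `≥ 1`. Then the restriction `Č(F) → Č(G)` is a
quasi-isomorphism. For `F s = Γ(W_s, 𝓕)` this is the statement that removing from a covering
`𝓦 = (W_i)_{i ∈ ι}` a member `W_v` on which `𝓕` is Čech-acyclic for the induced covering
`(W_v ∩ W_{i'})_{i' ≠ v}` (e.g. `W_v` affine, `𝓕` quasi-coherent, all `W_v ∩ W_{i'}` affine: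
Görtz–Wedhorn II, Thm. 22.2) induces `Ȟⁿ(𝓦, 𝓕) ≅ Ȟⁿ(𝓦 ∖ W_v, 𝓕)` — the inductive step of the
comparison of the Čech cohomology of two affine coverings (Görtz–Wedhorn II, Thm. 22.9, via
Cor. 21.82 (Leray); The Stacks Project, Tag 01FJ-style argument without spectral sequences):
the restriction is surjective in each degree with kernel the cochains vanishing off `v`, and that
kernel complex is acyclic (`eq_zero_of_vanishesOff_zero`, `exists_d_eq_of_vanishesOff_one`,
`exists_d_eq_of_vanishesOff_succ`), so the elementwise criterion `quasiIso_of_surj_inj` applies.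
[cite: GortzWedhorn2023, Thm. 22.9 with Cor. 21.82 and Thm. 22.2 (pp. 266, 328, 332)] -/
theorem quasiIso_restrictMapLE_of_deletion [Nonempty ι'] (e : ι' ↪o ι) (v : ι)
    (hv : ∀ i, i ∈ Set.range e ↔ i ≠ v) (hF : Monotone F) (hG : Monotone G)
    (heq : ∀ t : Finset ι', F (t.map e.toEmbedding) = G t)
    (H0 : (⨅ a : ι', F (insert v {e a})) ≤ F {v})
    (H1 : ∀ n : ℤ, 1 ≤ n → (complex (insFamily e v F) (insFamily_mono e v hF)).ExactAt n) :
    QuasiIso (restrictMapLE e (fun t => (heq t).le) hF hG) := by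
  have hle : ∀ t : Finset ι', F (t.map e.toEmbedding) ≤ G t := fun t => (heq t).le
  -- the kernel complex (cochains vanishing off `v`) is acyclic in degrees `≥ 1`
  have hker : ∀ j : ℤ, 0 ≤ j → ∀ g : Cochain F (j + 1), VanishesOff v g → d F hF (j + 1) g = 0 →
      ∃ h : Cochain F j, VanishesOff v h ∧ d F hF j h = g := by
    intro j hj g hg hdg
    rcases eq_or_lt_of_le hj with rfl | hj'
    · exact exists_d_eq_of_vanishesOff_one e v hv hF H0 g hg hdg
    · obtain ⟨p, rfl⟩ : ∃ p : ℤ, j = p + 1 := ⟨j - 1, by omega⟩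
      refine exists_d_eq_of_vanishesOff_succ e v hv hF p (by omega) ?_ g hg hdg
      have hex := (exactAt_iff_function_exact (complex (insFamily e v F) (insFamily_mono e v hF))
        p (p + 1) (p + 1 + 1) rfl rfl).1 (H1 (p + 1) (by omega))
      rw [complex_d, complex_d] at hex
      exact hex
  apply quasiIso_of_surj_inj
  · -- `Hʲ(Č(F)) → Hʲ(Č(G))` is surjective: extend a cocycle `z` by zero and correct by the kernel
    intro j z hz
    rcases lt_or_ge j 0 with hj | hj
    · haveI := isEmpty_simplex_of_neg (ι := ι') hj
      have hz0 : z = 0 := Subsingleton.elim (α := Cochain G j) z 0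
      refine ⟨0, by rw [map_zero], 0, ?_⟩
      rw [map_zero, map_zero, add_zero, hz0]
    · have hz' : d G hG j z = 0 := (complex_d_apply_eq_zero_iff hG rfl z).1 hz
      set x₀ := Cochain.extend e v hv heq j z with hx₀_def
      have hk : VanishesOff v (d F hF j x₀) :=
        vanishesOff_of_restrict_eq_zero e v hv hle (by
          rw [← d_restrictLE e hle hF hG, restrict_extend, hz'])
      obtain ⟨h, hh, hdh⟩ := hker j hj _ hk (d_d F hF j x₀)
      refine ⟨x₀ - h, ?_, 0, ?_⟩
      · rw [complex_d_apply_eq_zero_iff hF rfl, map_sub, hdh, sub_self]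
      · rw [map_zero, add_zero, restrictMapLE_f]
        change Cochain.restrictLE e hle j (x₀ - h) = z
        rw [map_sub, restrict_extend, restrict_eq_zero_of_vanishesOff e v hv hle hh, sub_zero]
  · -- `Hʲ⁺¹(Č(F)) → Hʲ⁺¹(Č(G))` is injective: a cocycle restricting to `d c` is `d(c̃ + h)`
    rintro j x hx ⟨c, hc⟩
    change Cochain F (j + 1) at x
    have hx' : d F hF (j + 1) x = 0 := (complex_d_apply_eq_zero_iff hF (by omega) x).1 hx
    rw [restrictMapLE_f, complex_d] at hc
    change Cochain.restrictLE e hle (j + 1) x = d G hG j c at hc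
    rcases lt_trichotomy j (-1) with hj | rfl | hj
    · haveI := isEmpty_simplex_of_neg (ι := ι) (show j + 1 < 0 by omega)
      refine ⟨0, ?_⟩
      rw [map_zero]
      exact (Subsingleton.elim (α := Cochain F (j + 1)) x 0).symm
    · -- degree `0`: the kernel complex has no cohomology in degree `0`
      rw [d_eq_zero_of_neg _ _ (-1) (by omega), LinearMap.zero_apply] at hc
      have hx0 : x = 0 :=
        eq_zero_of_vanishesOff_zero e v hv hF x (vanishesOff_of_restrict_eq_zero e v hv hle hc) hx'
      refine ⟨0, ?_⟩
      rw [map_zero]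
      exact hx0.symm
    · have hj0 : 0 ≤ j := by omega
      set c₀ := Cochain.extend e v hv heq j c with hc₀_def
      have hg : VanishesOff v (x - d F hF j c₀) :=
        vanishesOff_of_restrict_eq_zero e v hv hle (by
          rw [map_sub, hc, ← d_restrictLE e hle hF hG, restrict_extend, sub_self])
      have hdg : d F hF (j + 1) (x - d F hF j c₀) = 0 := by
        rw [map_sub, hx', d_d, sub_zero]
      obtain ⟨h, -, hdh⟩ := hker j hj0 _ hg hdg
      refine ⟨c₀ + h, ?_⟩
      rw [complex_d]
      change d F hF j (c₀ + h) = x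
      rw [map_add, hdh, add_sub_cancel]

end QuasiIso

/-! ### Deleting several acyclic members -/

section Induction

variable {𝕃 : Type u} [AddCommGroup 𝕃] [Module A 𝕃]

/-- **Iterated deletion** (induction on the number of deleted members). Let `e : ι' ↪o κ` be an
order embedding of finite index sets (`ι' ≠ ∅`), `F` a monotone family on `κ` and `G t = F (e t)`.
Suppose that for every index `v ∉ e(ι')` and every set of indices `S ∌ v` containing `e(ι')`,
`⋂_{a ∈ S} F {a, v} ⊆ F {v}` and the ordered Čech complex of `t ↦ F (t ∪ {v})`, `t ⊆ S`, is exact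
in all degrees `≥ 1` (for `F s = Γ(W_s, 𝓕)`: `𝓕` is Čech-acyclic on each deleted `W_v` for each of
the coverings `(W_v ∩ W_a)_{a ∈ S}`). Then the restriction `Č•(F) → Č•(G)` to the sub-covering is
a quasi-isomorphism: delete the members outside `e(ι')` one at a time
(`quasiIso_restrictMapLE_of_deletion`), reindexing along `κ ∖ {v} ≅ {a // a ≠ v}`
(`isIso_restrictMapLE`, `restrictMapLE_comp`). [cite: GortzWedhorn2023, Thm. 22.9 with Cor. 21.82 (pp. 266, 332)] -/
theorem quasiIso_restrictMapLE_of_forall_aux [Fintype ι'] [Nonempty ι'] (k : ℕ) :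
    ∀ {κ : Type} [LinearOrder κ] [Fintype κ] {F : Finset κ → Submodule A 𝕃} (hF : Monotone F)
      {G : Finset ι' → Submodule A 𝕃} (hG : Monotone G) (e : ι' ↪o κ)
      (heq : ∀ t : Finset ι', F (t.map e.toEmbedding) = G t),
      Fintype.card κ = Fintype.card ι' + k →
      (∀ v : κ, v ∉ Set.range e → ∀ S : Finset κ, Set.range e ⊆ (S : Set κ) → v ∉ S →
        (⨅ a : ↥S, F (insert v {(a : κ)})) ≤ F {v} ∧
        ∀ n : ℤ, 1 ≤ n → (complex (insFamily (OrderEmbedding.subtype (· ∈ S)) v F)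
          (insFamily_mono (OrderEmbedding.subtype (· ∈ S)) v hF)).ExactAt n) →
      QuasiIso (restrictMapLE e (fun t => (heq t).le) hF hG) := by
  induction k with
  | zero =>
    intro κ _ _ F hF G hG e heq hcard _
    have hsurj : Function.Surjective e :=
      ((Fintype.bijective_iff_injective_and_card e).2 ⟨e.injective, by omega⟩).2
    haveI := isIso_restrictMapLE e (fun t => (heq t).le) hF hG hsurj heq
    infer_instance
  | succ k ih =>
    intro κ _ _ F hF G hG e heq hcard HS
    -- an index `v` outside the range of `e`
    obtain ⟨v, hv⟩ : ∃ v : κ, v ∉ Set.range e := by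
      by_contra h
      have h' : Function.Surjective e := fun v => by_contra fun hv => h ⟨v, hv⟩
      have := Fintype.card_le_of_surjective e h'
      omega
    have hne : ∀ i', e i' ≠ v := fun i' h => hv ⟨i', h⟩
    -- delete `v`: `κ₁ = κ ∖ {v}`, `e = e' ≫ e₁`
    set S₀ : Finset κ := Finset.univ.erase v with hS₀_def
    have hmemS₀ : ∀ i, i ∈ S₀ ↔ i ≠ v := fun i => by
      rw [hS₀_def, Finset.mem_erase, and_iff_left (Finset.mem_univ _)]
    let e₁ : ↥S₀ ↪o κ := OrderEmbedding.subtype (· ∈ S₀)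
    have hv₁ : ∀ i, i ∈ Set.range e₁ ↔ i ≠ v := fun i =>
      ⟨fun ⟨a, ha⟩ => ha ▸ (hmemS₀ _).1 a.2, fun hi => ⟨⟨i, (hmemS₀ i).2 hi⟩, rfl⟩⟩
    let e' : ι' ↪o ↥S₀ :=
      OrderEmbedding.ofMapLEIff (fun i' => ⟨e i', (hmemS₀ _).2 (hne i')⟩) fun _ _ => e.le_iff_le
    have he : ∀ i', e i' = (e'.trans e₁) i' := fun _ => rfl
    -- Step 1: `Č(F) → Č(F ∘ e₁)` is a quasi-isomorphism (one deletion)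
    obtain ⟨H0, H1⟩ := HS v hv S₀ (by rintro _ ⟨i', rfl⟩; exact (hmemS₀ _).2 (hne i'))
      fun h => (hmemS₀ v).1 h rfl
    haveI : Nonempty ↥S₀ := ⟨e' (Classical.arbitrary ι')⟩
    have hle₁ : ∀ t : Finset ↥S₀, F (t.map e₁.toEmbedding) ≤ comapFamily e₁ F t := fun _ => le_rfl
    haveI q₁ : QuasiIso (restrictMapLE e₁ hle₁ hF (comapFamily_mono e₁ hF)) :=
      quasiIso_restrictMapLE_of_deletion e₁ v hv₁ hF (comapFamily_mono e₁ hF) (fun _ => rfl) H0 H1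
    -- Step 2: `Č(F ∘ e₁) → Č(G)` is a quasi-isomorphism (induction)
    have hcard₁ : Fintype.card ↥S₀ = Fintype.card ι' + k := by
      rw [Fintype.card_coe, hS₀_def, Finset.card_erase_of_mem (Finset.mem_univ v), Finset.card_univ]
      omega
    have heq' : ∀ t : Finset ι', comapFamily e₁ F (t.map e'.toEmbedding) = G t := fun t => by
      rw [comapFamily_apply, Finset.map_map]
      exact heq t
    have HS₁ : ∀ v₁ : ↥S₀, v₁ ∉ Set.range e' → ∀ S₁ : Finset ↥S₀, Set.range e' ⊆ (S₁ : Set ↥S₀) →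
        v₁ ∉ S₁ →
        (⨅ a : ↥S₁, comapFamily e₁ F (insert v₁ {(a : ↥S₀)})) ≤ comapFamily e₁ F {v₁} ∧
        ∀ n : ℤ, 1 ≤ n → (complex (insFamily (OrderEmbedding.subtype (· ∈ S₁)) v₁ (comapFamily e₁ F))
          (insFamily_mono (OrderEmbedding.subtype (· ∈ S₁)) v₁ (comapFamily_mono e₁ hF))).ExactAt n := by
      intro v₁ hv₁' S₁ hS₁ hvS₁
      -- the corresponding data in `κ`
      have hi : (v₁ : κ) ∉ Set.range e := by
        rintro ⟨i', hi'⟩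
        exact hv₁' ⟨i', Subtype.ext hi'⟩
      have hii : Set.range e ⊆ ((S₁.map e₁.toEmbedding : Finset κ) : Set κ) := by
        rintro _ ⟨i', rfl⟩
        rw [Finset.mem_coe, he i']
        exact Finset.mem_map_of_mem _ (hS₁ ⟨i', rfl⟩)
      have hiii : (v₁ : κ) ∉ S₁.map e₁.toEmbedding := fun h =>
        hvS₁ ((Finset.mem_map' e₁.toEmbedding).1 h)
      obtain ⟨h0, h1⟩ := HS (v₁ : κ) hi (S₁.map e₁.toEmbedding) hii hiii
      refine ⟨?_, fun n hn => ?_⟩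
      · refine le_trans (le_iInf fun b => ?_) (le_of_le_of_eq h0 ?_)
        · obtain ⟨a, ha, hab⟩ := Finset.mem_map.1 b.2
          refine iInf_le_of_le ⟨a, ha⟩ (le_of_eq ?_)
          rw [comapFamily_apply, Finset.map_insert, Finset.map_singleton, ← hab]
          rfl
        · rw [comapFamily_apply, Finset.map_singleton]
          rfl
      · -- reindex along `↥S₁ ≅ ↥(e₁ S₁)`
        let θ : ↥S₁ ↪o ↥(S₁.map e₁.toEmbedding) :=
          OrderEmbedding.ofMapLEIff (fun a => ⟨e₁ a.1, Finset.mem_map_of_mem _ a.2⟩)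
            fun _ _ => e₁.le_iff_le
        have hθ : Function.Surjective θ := fun b => by
          obtain ⟨a, ha, hab⟩ := Finset.mem_map.1 b.2
          exact ⟨⟨a, ha⟩, Subtype.ext hab⟩
        have heqθ : ∀ t : Finset ↥S₁,
            insFamily (OrderEmbedding.subtype (· ∈ S₁.map e₁.toEmbedding)) (v₁ : κ) F
                (t.map θ.toEmbedding) =
              insFamily (OrderEmbedding.subtype (· ∈ S₁)) v₁ (comapFamily e₁ F) t := fun t => by
          rw [insFamily_apply, insFamily_apply, comapFamily_apply, Finset.map_insert, Finset.map_map,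
            Finset.map_map]
          rfl
        haveI := isIso_restrictMapLE θ (fun t => (heqθ t).le) (insFamily_mono _ _ hF)
          (insFamily_mono _ _ (comapFamily_mono e₁ hF)) hθ heqθ
        exact (h1 n hn).of_iso (asIso (restrictMapLE θ (fun t => (heqθ t).le) (insFamily_mono _ _ hF)
          (insFamily_mono _ _ (comapFamily_mono e₁ hF))))
    haveI q₂ : QuasiIso (restrictMapLE e' (fun t => (heq' t).le) (comapFamily_mono e₁ hF) hG) :=
      ih (comapFamily_mono e₁ hF) hG e' heq' hcard₁ HS₁
    -- Step 3: compose
    rw [restrictMapLE_congr e (fun t => (heq t).le) hF hG he (fun t => (heq t).le),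
      restrictMapLE_comp e₁ hle₁ hF (comapFamily_mono e₁ hF) e' hG (fun t => (heq' t).le)
        (fun t => (heq t).le)]
    infer_instance

/-- **The Čech complex of a covering and of a sub-covering agree when the deleted members are
acyclic** (Görtz–Wedhorn II, Thm. 22.9, comparison step, in the form: for finite coverings
`𝓦' ⊆ 𝓦` by members on which `𝓕` is Čech-acyclic, `Č•(𝓦, 𝓕) → Č•(𝓦', 𝓕)` is a
quasi-isomorphism). Hypotheses as in `quasiIso_restrictMapLE_of_forall_aux`, for an order embedding
`e : ι' ↪o ι` of finite index sets with `ι' ≠ ∅` and `G t = F (e t)`.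
[cite: GortzWedhorn2023, Thm. 22.9 with Cor. 21.82 (pp. 266, 332)] -/
theorem quasiIso_restrictMapLE_of_forall [Fintype ι] [Fintype ι'] [Nonempty ι']
    {F : Finset ι → Submodule A 𝕃} (hF : Monotone F) {G : Finset ι' → Submodule A 𝕃}
    (hG : Monotone G) (e : ι' ↪o ι) (heq : ∀ t : Finset ι', F (t.map e.toEmbedding) = G t)
    (HS : ∀ v : ι, v ∉ Set.range e → ∀ S : Finset ι, Set.range e ⊆ (S : Set ι) → v ∉ S →
      (⨅ a : ↥S, F (insert v {(a : ι)})) ≤ F {v} ∧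
      ∀ n : ℤ, 1 ≤ n → (complex (insFamily (OrderEmbedding.subtype (· ∈ S)) v F)
        (insFamily_mono (OrderEmbedding.subtype (· ∈ S)) v hF)).ExactAt n) :
    QuasiIso (restrictMapLE e (fun t => (heq t).le) hF hG) := by
  have hk : Fintype.card ι' ≤ Fintype.card ι := Fintype.card_le_of_embedding e.toEmbedding
  exact quasiIso_restrictMapLE_of_forall_aux (Fintype.card ι - Fintype.card ι') hF hG e heq (by omega) HS

end Induction

end OrderedCech

end Literature.Algebra.Homology
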